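import Summits.QuantumFields.GaugeBoot.SOMasterLoopAssembly
import Literature.MathematicalPhysics.QuantumFieldTheory.Chatterjee2019LargeN.FiniteNMasterLoopSymmetrization
import Literature.MathematicalPhysics.QuantumFieldTheory.Chatterjee2019LargeN.MasterLoopUniqueness
import HarnessLib

/-!
# CHATTERJEE'S THEOREM 8.1 — the finite-`N` `SO(N)` master loop equation at a marked edge — PROVED (gauge-boot, ADDENDUM 27 part M5e)

HONEST FRAMING (cell `pub-gaugeboot`, page 1 of every file): the venture produces certified bounds
on lattice expectations at stated coupling, gauge group, dimension and torus size; NOT a mass gap,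
NOT a continuum limit, NOT a string tension; NOT Yang–Mills-summit-bearing (barriers
`FixedCouplingUltralocality`, `PerturbativeInvisibility`).  This file DISCHARGES a named fact of the Literature layer about
`SO(N)` lattice gauge theory with free boundary conditions (an exact identity at every `N ≥ 2`, every real coupling,
every finite region); its printed consequences concern the STRONG-COUPLING LARGE-`N` limit of that theory and say nothing
about four-dimensional continuum Yang–Mills or a mass gap.

## Content

Twelfth and last file of the lane's programme.  ★★★ `unsymmetrizedMasterLoopEquation_holds : UnsymmetrizedMasterLoopEquation d`
— S. Chatterjee, *Rigorous solution of strongly coupled `SO(N)` lattice gauge theory in the large `N` limit*, Comm. Math.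
Phys. 366 (2019) 203–268, **Theorem 8.1**: for `N ≥ 2`, real `β`, a finite `Λ ⊆ ℤ^d` containing every vertex at
distance `≤ 1` from the loops, a loop sequence `(l₁, …, lₙ)` and a marked location of `l₁` with letter `e`, occurring
`m` times (as `e^{±1}`) in `l₁`:

  `(N − 1)·m·⟨W_{l₁} W_{l₂} ⋯ W_{lₙ}⟩ = twisting + splitting + merger + Nβ·deformation`

(the four terms of `MasterLoopEquation.twistTermAt/splitTermAt/mergeTermAt/deformTermAt`).  The tree typed this as a
NAMED FACT (flag F7 of `MasterLoopEquation.lean` pointed at the lane's one-link Schwinger–Dyson files as the intended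
prover); parts M0–M5d of this ADDENDUM supply the proof: the one-link Haar-shift identity of the free Wilson measure at
the marked link, differentiated along the `𝔰𝔬(N)` directions `X_ij = E_ij − E_ji` with the test function
`X̃_ij(W_{l₁})·Π_{r≥2} W_{l_r}`, summed over `(i, j)` — the completeness relation `Σ X A X = 2(Aᵀ − tr A·1)` producing
exactly the twistings (transpose), splittings (trace), mergers and deformations (`Σ tr(XA)tr(XB) = 2(tr(ABᵀ) − tr(AB))`)
and the Casimir `Σ X² = −2(N−1)` the coefficient `(N−1)m`.

CONSEQUENCES, now unconditional (one-liners over the tree's `_of_unsymmetrized` theorems of the `Chatterjee2019LargeN`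
directory): ★★★ `finiteNMasterLoopEquation_holds` (Theorem 3.6), ★★★ `thooftLimit_holds` (Theorem 9.2: THE 'T HOOFT LIMIT
`lim_{N→∞} ⟨W_{l₁}⋯W_{lₙ}⟩/Nⁿ` EXISTS for `|β| ≤ β₀(d)`), ★★★ `masterLoopUniqueness_holds` (Theorem 9.2, uniqueness),
`thooftMasterLoopEquation_holds` (Theorem 9.1, the `N = ∞` Makeenko–Migdal equation of every subsequential limit, every
`β`), `symmetrizedLimitMasterLoopEquation_holds` (Theorem 9.9).  Theorem 3.1 (`GaugeStringDuality`: the limit equals the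
string-trajectory sum) is NOT claimed here.

Everything is `[folklore]` given the source; the proof technique (integration by parts on one link) is the source's §§5–8.
-/

noncomputable section

open NormedSpace MeasureTheory
open scoped Matrix.Norms.Frobenius Matrix
open Literature.Probability.LatticeModels (Site)
open Literature.MathematicalPhysics.QuantumLattice (LGConfig ZdEdge ZdPlaquette plaquettesTouching)
open Literature.MathematicalPhysics.QuantumFieldTheory (Chatterjee2019LargeN.Word zdWilsonMeasure plaquettesIn latticeNorm)
open Literature.MathematicalPhysics.QuantumFieldTheory.Chatterjee2019LargeN
  (SO soRep DEdge LoopSeq wilsonLoopVar wilsonProd soExpect soMeasure plaquettesAt IsLoopSeq twistTermAt splitTermAt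
   mergeTermAt deformTermAt UnsymmetrizedMasterLoopEquation FiniteNMasterLoopEquation THooftLimit MasterLoopUniqueness
   THooftMasterLoopEquation SymmetrizedLimitMasterLoopEquation finiteNMasterLoopEquation_of_unsymmetrized
   thooftLimit_of_unsymmetrized masterLoopUniqueness_of_unsymmetrized thooftMasterLoopEquation_of_unsymmetrized
   symmetrizedLimitMasterLoopEquation_of_unsymmetrized)
open Literature.MathematicalPhysics.QuantumFieldTheory.Chatterjee2019LargeN.Word
  (locs occ samePairs invPairs posSplit₁ posSplit₂ negSplit₁ negSplit₂ negTwist posTwist posMerge negMerge posDeform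
   negDeform)

namespace Summit.QuantumFields.GaugeBoot

namespace SOMasterLoop

variable {d N : ℕ}

/-! ## The spectator product with one component removed -/

/-- `Π_{r' ≠ r} f(s_{r'}) = Π f over s.eraseIdx r`. [folklore] -/
theorem prod_univ_erase_eq_prod_eraseIdx {α M : Type*} [CommMonoid M] (f : α → M) :
    ∀ (s : List α) (r : Fin s.length), ∏ r' ∈ Finset.univ.erase r, f (s.get r') = ((s.eraseIdx r).map f).prod
  | [], r => r.elim0
  | a :: t, r => by
    have hs : (Finset.univ : Finset (Fin (t.length + 1))).erase r = Finset.univ.image r.succAbove := by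
      ext x
      simp [eq_comm]
    change ∏ r' ∈ (Finset.univ : Finset (Fin (t.length + 1))).erase r, f ((a :: t).get r') = _
    rw [hs, Finset.prod_image (fun x _ y _ h => Fin.succAbove_right_injective h), prod_map_eq_prod_fin]
    have hlen : ((a :: t).eraseIdx r).length = t.length := by rw [List.length_eraseIdx_of_lt r.isLt]; rfl
    rw [← (finCongr hlen.symm).prod_comp]
    refine Finset.prod_congr rfl fun i _ => ?_
    simp only [finCongr_apply, List.get_eq_getElem, Fin.val_cast, List.getElem_eraseIdx]
    by_cases hi : i.castSucc < r
    · rw [Fin.succAbove_of_castSucc_lt _ _ hi]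
      have : (i : ℕ) < r := hi
      simp [this]
    · rw [Fin.succAbove_of_le_castSucc _ _ (not_lt.1 hi)]
      have : ¬ (i : ℕ) < r := fun h => hi h
      simp [this]

/-- Hence: `Π_{r' ≠ r} W_{l_{r'}} = wilsonProd (rest.eraseIdx r)`. [folklore] -/
theorem prod_erase_wilsonLoopVar (rest : LoopSeq d) (r : Fin rest.length) (U : LGConfig d (SO N)) :
    ∏ r' ∈ Finset.univ.erase r, wilsonLoopVar N (rest.get r') U = wilsonProd N (rest.eraseIdx r) U := by
  rw [wilsonProd]
  exact prod_univ_erase_eq_prod_eraseIdx (fun w => wilsonLoopVar N w U) rest r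

/-- `W_{l₁} ⋯` of a `cons`. [folklore] -/
theorem wilsonProd_cons (w : Chatterjee2019LargeN.Word d) (s : LoopSeq d) (U : LGConfig d (SO N)) :
    wilsonProd N (w :: s) U = wilsonLoopVar N w U * wilsonProd N s U := by
  simp [wilsonProd]

/-! ## The four terms of Theorem 8.1 as integrals of the four integrands -/

section Terms

variable (β : ℝ) (Λ : Finset (Site d)) (l : Chatterjee2019LargeN.Word d) (rest : LoopSeq d) (e : DEdge d)

/-- `F(s') = ⟨Π_{l'∈s'} W_{l'}⟩` unfolds to an integral against the free Wilson measure. [folklore] -/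
theorem soExpect_eq (s : LoopSeq d) :
    soExpect N β Λ (wilsonProd N s) = ∫ U, wilsonProd N s U ∂(zdWilsonMeasure (soRep N) (N * β) Λ) := rfl

/-- The twisting term is `∫ twistFun · Π W`. [folklore] -/
theorem twistTermAt_eq :
    twistTermAt (fun s' => soExpect N β Λ (wilsonProd N s')) l rest e =
      ∫ U, twistFun N l e U * wilsonProd N rest U ∂(zdWilsonMeasure (soRep N) (N * β) Λ) := by
  have cP := continuous_wilsonProd (N := N) (d := d) rest
  have hI : ∀ w : Chatterjee2019LargeN.Word d, Integrable (fun U : LGConfig d (SO N) =>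
      wilsonLoopVar N w U * wilsonProd N rest U) (zdWilsonMeasure (soRep N) (N * β) Λ) :=
    fun w => integrable_real_of_continuous _ _ ((continuous_wilsonLoopVar w).mul cP)
  have hS : ∀ S : Finset (Fin l.length × Fin l.length), ∀ f : Fin l.length × Fin l.length → Chatterjee2019LargeN.Word d,
      Integrable (fun U : LGConfig d (SO N) => ∑ xy ∈ S, wilsonLoopVar N (f xy) U * wilsonProd N rest U)
        (zdWilsonMeasure (soRep N) (N * β) Λ) :=
    fun S f => integrable_finsetSum _ fun xy _ => hI (f xy)
  simp only [twistTermAt, soExpect_eq, wilsonProd_cons, twistFun, sub_mul, Finset.sum_mul]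
  rw [integral_sub (hS _ fun xy => negTwist l xy.1 xy.2) (hS _ fun xy => posTwist l xy.1 xy.2),
    integral_finsetSum _ (fun xy _ => hI _), integral_finsetSum _ (fun xy _ => hI _)]

/-- The splitting term is `∫ splitFun · Π W`. [folklore] -/
theorem splitTermAt_eq :
    splitTermAt (fun s' => soExpect N β Λ (wilsonProd N s')) l rest e =
      ∫ U, splitFun N l e U * wilsonProd N rest U ∂(zdWilsonMeasure (soRep N) (N * β) Λ) := by
  have cP := continuous_wilsonProd (N := N) (d := d) rest
  have hi : ∀ w w' : Chatterjee2019LargeN.Word d, Integrable (fun U : LGConfig d (SO N) =>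
      wilsonLoopVar N w U * wilsonLoopVar N w' U * wilsonProd N rest U) (zdWilsonMeasure (soRep N) (N * β) Λ) :=
    fun w w' => integrable_real_of_continuous _ _ (((continuous_wilsonLoopVar _).mul (continuous_wilsonLoopVar _)).mul cP)
  have hS : ∀ S : Finset (Fin l.length × Fin l.length), ∀ f g : Fin l.length × Fin l.length → Chatterjee2019LargeN.Word d,
      Integrable (fun U : LGConfig d (SO N) => ∑ xy ∈ S, wilsonLoopVar N (f xy) U * wilsonLoopVar N (g xy) U * wilsonProd N rest U)
        (zdWilsonMeasure (soRep N) (N * β) Λ) :=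
    fun S f g => integrable_finsetSum _ fun xy _ => hi (f xy) (g xy)
  simp only [splitTermAt, soExpect_eq, wilsonProd_cons, splitFun, sub_mul, Finset.sum_mul, ← mul_assoc]
  rw [integral_sub (hS _ (fun xy => negSplit₁ l xy.1 xy.2) fun xy => negSplit₂ l xy.1 xy.2)
      (hS _ (fun xy => posSplit₁ l xy.1 xy.2) fun xy => posSplit₂ l xy.1 xy.2),
    integral_finsetSum _ (fun xy _ => hi _ _), integral_finsetSum _ (fun xy _ => hi _ _)]

/-- The merger term is `∫ mergeFun`. [folklore] -/
theorem mergeTermAt_eq :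
    mergeTermAt (fun s' => soExpect N β Λ (wilsonProd N s')) l rest e =
      ∫ U, mergeFun N l rest e U ∂(zdWilsonMeasure (soRep N) (N * β) Λ) := by
  have hi : ∀ (w : Chatterjee2019LargeN.Word d) (r : Fin rest.length), Integrable (fun U : LGConfig d (SO N) =>
      wilsonLoopVar N w U * wilsonProd N (rest.eraseIdx r) U) (zdWilsonMeasure (soRep N) (N * β) Λ) :=
    fun w r => integrable_real_of_continuous _ _ ((continuous_wilsonLoopVar _).mul (continuous_wilsonProd _))
  have hm : ∀ U : LGConfig d (SO N), mergeFun N l rest e U = ∑ r : Fin rest.length, ∑ x ∈ locs l e,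
      ∑ y ∈ locs (rest.get r) e, (wilsonLoopVar N (negMerge l x (rest.get r) y) U * wilsonProd N (rest.eraseIdx r) U -
        wilsonLoopVar N (posMerge l x (rest.get r) y) U * wilsonProd N (rest.eraseIdx r) U) := by
    intro U
    simp only [mergeFun, prod_erase_wilsonLoopVar, Finset.mul_sum]
    refine Finset.sum_congr rfl fun r _ => Finset.sum_congr rfl fun x _ => Finset.sum_congr rfl fun y _ => ?_
    ring
  have hd : ∀ (r : Fin rest.length) (x : Fin l.length) (y : Fin (rest.get r).length), Integrable (fun U : LGConfig d (SO N) =>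
      wilsonLoopVar N (negMerge l x (rest.get r) y) U * wilsonProd N (rest.eraseIdx r) U -
        wilsonLoopVar N (posMerge l x (rest.get r) y) U * wilsonProd N (rest.eraseIdx r) U)
      (zdWilsonMeasure (soRep N) (N * β) Λ) := fun r x y => (hi _ r).sub (hi _ r)
  simp only [mergeTermAt, soExpect_eq, wilsonProd_cons, hm]
  rw [integral_finsetSum _ (fun r _ => integrable_finsetSum _ fun x _ => integrable_finsetSum _ fun y _ => hd r x y),
    ← Finset.sum_sub_distrib]
  refine Finset.sum_congr rfl fun r _ => ?_
  rw [integral_finsetSum _ (fun x _ => integrable_finsetSum _ fun y _ => hd r x y), ← Finset.sum_sub_distrib]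
  refine Finset.sum_congr rfl fun x _ => ?_
  rw [integral_finsetSum _ (fun y _ => hd r x y), ← Finset.sum_sub_distrib]
  refine Finset.sum_congr rfl fun y _ => ?_
  rw [integral_sub (hi _ _) (hi _ _)]

/-- The deformation term is `∫ deformFun · Π W`. [folklore] -/
theorem deformTermAt_eq :
    deformTermAt (fun s' => soExpect N β Λ (wilsonProd N s')) l rest e =
      ∫ U, deformFun N l e U * wilsonProd N rest U ∂(zdWilsonMeasure (soRep N) (N * β) Λ) := by
  have cP := continuous_wilsonProd (N := N) (d := d) rest
  have hi : ∀ w : Chatterjee2019LargeN.Word d, Integrable (fun U : LGConfig d (SO N) =>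
      wilsonLoopVar N w U * wilsonProd N rest U) (zdWilsonMeasure (soRep N) (N * β) Λ) :=
    fun w => integrable_real_of_continuous _ _ ((continuous_wilsonLoopVar _).mul cP)
  have hD : ∀ U : LGConfig d (SO N), deformFun N l e U * wilsonProd N rest U = ∑ p ∈ plaquettesAt e, ∑ x ∈ locs l e,
      (wilsonLoopVar N (negDeform l x p) U * wilsonProd N rest U - wilsonLoopVar N (posDeform l x p) U * wilsonProd N rest U) := by
    intro U
    simp only [deformFun, Finset.sum_mul, sub_mul]
  have hd : ∀ (p : ZdPlaquette d) (x : Fin l.length), Integrable (fun U : LGConfig d (SO N) =>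
      wilsonLoopVar N (negDeform l x p) U * wilsonProd N rest U - wilsonLoopVar N (posDeform l x p) U * wilsonProd N rest U)
      (zdWilsonMeasure (soRep N) (N * β) Λ) := fun p x => (hi _).sub (hi _)
  simp only [deformTermAt, soExpect_eq, wilsonProd_cons, hD]
  rw [integral_finsetSum _ (fun p _ => integrable_finsetSum _ fun x _ => hd p x), ← Finset.sum_sub_distrib]
  refine Finset.sum_congr rfl fun p _ => ?_
  rw [integral_finsetSum _ (fun x _ => hd p x), ← Finset.sum_sub_distrib]
  refine Finset.sum_congr rfl fun x _ => ?_
  rw [integral_sub (hi _) (hi _)]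

end Terms

/-! ## Theorem 8.1 and its printed consequences -/

variable (d)

/-- ★★★ **CHATTERJEE'S THEOREM 8.1 (the finite-`N` master loop equation at a marked edge), PROVED** — the named fact
`UnsymmetrizedMasterLoopEquation` of the tree: `(N−1)·m·⟨W_{l₁}⋯W_{lₙ}⟩ = twisting + splitting + merger + Nβ·deformation`
for `SO(N)` lattice gauge theory with free boundary condition on any finite `Λ ⊆ ℤ^d` containing the unit
neighbourhood of the loops, any `N ≥ 2`, any real `β`. [cite: Chatterjee2019LargeN, Theorem 8.1] -/
theorem unsymmetrizedMasterLoopEquation_holds : UnsymmetrizedMasterLoopEquation d := by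
  intro hd Λ N hN β l rest hloop hΛ x₀
  have hl := plaquettes_mem_of_vertices (s := l :: rest) (List.mem_cons_self) hΛ x₀
  have h := masterLoop_real_identity (N := N) (N * β) Λ l rest (l.get x₀) hl
  rw [twistTermAt_eq, splitTermAt_eq, mergeTermAt_eq, deformTermAt_eq, soExpect_eq]
  simp only [wilsonProd_cons]
  rw [h]

/-- ★★★ **Theorem 3.6 (the finite-`N` master loop equation), unconditional.** [cite: Chatterjee2019LargeN, Theorem 3.6] -/
theorem finiteNMasterLoopEquation_holds : FiniteNMasterLoopEquation d :=
  finiteNMasterLoopEquation_of_unsymmetrized (unsymmetrizedMasterLoopEquation_holds d)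

/-- ★★★ **Theorem 9.2 (existence of the 't Hooft limit at strong coupling), unconditional**: there is `β₀(d) > 0` such
that for `|β| ≤ β₀` and every exhaustion `Λ_N ↑ ℤ^d`, `⟨W_{l₁}⋯W_{lₙ}⟩_{Λ_N,N,β}/Nⁿ` converges as `N → ∞` for every loop
sequence. [cite: Chatterjee2019LargeN, Theorem 9.2] -/
theorem thooftLimit_holds : THooftLimit d :=
  thooftLimit_of_unsymmetrized (unsymmetrizedMasterLoopEquation_holds d)

/-- ★★★ **Theorem 9.2 (uniqueness of the solution of the master loop equation), unconditional.**
[cite: Chatterjee2019LargeN, Theorem 9.2] -/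
theorem masterLoopUniqueness_holds : MasterLoopUniqueness d :=
  masterLoopUniqueness_of_unsymmetrized (unsymmetrizedMasterLoopEquation_holds d)

/-- ★★ **Theorem 9.1 (the `N = ∞` Makeenko–Migdal equation of every subsequential 't Hooft limit, every `β`),
unconditional.** [cite: Chatterjee2019LargeN, Theorem 9.1] -/
theorem thooftMasterLoopEquation_holds : THooftMasterLoopEquation d :=
  thooftMasterLoopEquation_of_unsymmetrized (unsymmetrizedMasterLoopEquation_holds d)

/-- ★★ **Theorem 9.9 (the symmetrized limiting master loop equation), unconditional.** [cite: Chatterjee2019LargeN, Theorem 9.9] -/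
theorem symmetrizedLimitMasterLoopEquation_holds : SymmetrizedLimitMasterLoopEquation d :=
  symmetrizedLimitMasterLoopEquation_of_unsymmetrized (unsymmetrizedMasterLoopEquation_holds d)

end SOMasterLoop

end Summit.QuantumFields.GaugeBoot
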